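import Mathlib
import Summits.Ventures.HodgeRepro.GaussSumOddConductor

/-!
# GaussSumConjEvenShift — the stationary point of a conjugate-dual character is `σ`-ANTI-fixed when `ψ` is `σ`-even

Blind re-derivation cell `pub-hodge-repro`, seat night-2 (gen 5).  Target tree path
`lean/Summits/Ventures/HodgeRepro/GaussSumConjEvenShift.lean`.  The `σ`-even companion of
`GaussSumEvenConductor.conj_sub_mem_of_conjDual`: on gen 1's model, if `ρ ∘ σ = ρ⁻¹` on `R`, `ρ(1 + z) = ψ(a z)` on
`I`, and `ψ ∘ σ = ψ` (the situation of the ODD conductors at `𝔭 | 5`, `OcticCMPointEightOddShift`), then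
`ψ((σ(a) + a) z) = 1` for all `z ∈ I`, i.e. **`σ(a) + a ∈ Ann_ψ(I)`** (`conj_add_mem_ann_of_conjDual`); when
`Ann_ψ(I) = I` this reads `σ(a) ≡ −a mod I` (`conj_add_mem_of_conjDual`): the stationary point is `σ`-anti-fixed
mod `I`, where for `σ`-odd `ψ` it is `σ`-fixed.  With the odd reduction (`gaussSum_eq_sum_ann`) this is the first
step of the odd-conductor analysis left to the successor (QUICKSTART-g6).

**What this is not.**  No odd-conductor root number is computed.  Nothing here says anything about the status of the
Hodge conjecture for CM abelian varieties, which is NOT proved.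
-/

set_option autoImplicit false

noncomputable section

open Finset Classical

namespace Summit.Ventures.HodgeRepro.GaussSumStability

variable {R : Type} [CommRing R]

/-- **`σ`-even `ψ`: the stationary point is `σ`-anti-fixed modulo the annihilator**: `σ(a) + a ∈ Ann_ψ(I)`. -/
theorem conj_add_mem_ann_of_conjDual (ψ : AddChar R ℂ) (I : Ideal R) (σ : R →+* R) (hσσ : ∀ x, σ (σ x) = x)
    (hσI : ∀ z ∈ I, σ z ∈ I) (hψσ : ∀ x, ψ (σ x) = ψ x) (ρ : MulChar R ℂ) (hρσ : ∀ x, ρ (σ x) = ρ⁻¹ x)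
    (a : Rˣ) (hρ : ∀ z ∈ I, ρ (1 + z) = ψ (a * z)) :
    PsiAnn ψ I (σ (a : R) + a) := by
  intro z hz
  -- `ρ(1 + σ z) = ρ(σ(1 + z)) = ρ⁻¹(1 + z) = ψ(a z)⁻¹ = ψ(−a z)`
  have h1 : ρ (1 + σ z) = ψ (-((a : R) * z)) := by
    rw [← map_one σ, ← map_add, hρσ, MulChar.inv_apply_eq_inv', hρ z hz, AddChar.map_neg_eq_inv]
  -- `ρ(1 + σ z) = ψ(a σ z) = ψ(σ(σ(a) z)) = ψ(σ(a) z)`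
  have h2 : ρ (1 + σ z) = ψ (σ (a : R) * z) := by
    rw [hρ (σ z) (hσI z hz), ← hψσ (σ (a : R) * z), map_mul σ, hσσ]
  have h3 : ψ (-((a : R) * z)) = ψ (σ (a : R) * z) := h1.symm.trans h2
  calc ψ ((σ (a : R) + a) * z) = ψ (σ (a : R) * z) * ψ ((a : R) * z) := by
        rw [← AddChar.map_add_eq_mul]; congr 1; ring
    _ = ψ (-((a : R) * z)) * ψ ((a : R) * z) := by rw [h3]
    _ = 1 := by rw [← AddChar.map_add_eq_mul, neg_add_cancel, AddChar.map_zero_eq_one]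

/-- When `Ann_ψ(I) = I` (even conductor with a `σ`-even `ψ`): `σ(a) + a ∈ I`. -/
theorem conj_add_mem_of_conjDual (ψ : AddChar R ℂ) (I : Ideal R) (hA : ∀ x, PsiAnn ψ I x ↔ x ∈ I)
    (σ : R →+* R) (hσσ : ∀ x, σ (σ x) = x) (hσI : ∀ z ∈ I, σ z ∈ I) (hψσ : ∀ x, ψ (σ x) = ψ x)
    (ρ : MulChar R ℂ) (hρσ : ∀ x, ρ (σ x) = ρ⁻¹ x) (a : Rˣ) (hρ : ∀ z ∈ I, ρ (1 + z) = ψ (a * z)) :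
    σ (a : R) + a ∈ I :=
  (hA _).1 (conj_add_mem_ann_of_conjDual ψ I σ hσσ hσI hψσ ρ hρσ a hρ)

/-- For a `σ`-even `ψ` the function `w ↦ ψ(a w)` is `σ`-symmetric exactly when `σ(a) − a` annihilates: in particular,
if `σ(a) + a ∈ Ann_ψ(I)` then `ψ(a σ(z)) = ψ(−a z)` on `I` (the shape of the conjugate-dual condition on `1 + I`). -/
theorem psi_mul_conj_eq_neg (ψ : AddChar R ℂ) (I : Ideal R) (σ : R →+* R) (hσσ : ∀ x, σ (σ x) = x)
    (hψσ : ∀ x, ψ (σ x) = ψ x) (a : R) (ha : PsiAnn ψ I (σ a + a)) (z : R) (hz : z ∈ I) :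
    ψ (a * σ z) = ψ (-(a * z)) := by
  have h := ha z hz
  rw [show a * σ z = σ (σ a * z) by rw [map_mul, hσσ], hψσ]
  rw [add_mul, AddChar.map_add_eq_mul] at h
  -- `ψ(σ(a) z) ψ(a z) = 1`, so `ψ(σ(a) z) = ψ(a z)⁻¹ = ψ(−a z)`
  rw [AddChar.map_neg_eq_inv]
  exact eq_inv_of_mul_eq_one_left h

end Summit.Ventures.HodgeRepro.GaussSumStability

end
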